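import Summits.QuantumFields.YangMills.Theorems.SusceptibilityToPoincare.Negative.Bottleneck

/-!
# `SusceptibilityToPoincare` — negative side: metastable sets of vanishing mass also kill the heat-bath Poincaré inequality

Negative-side support for crux `stmt-QuantumFields-9441`
(`Summit.QuantumFields.YangMills.Theses.FradkinShenkerFlow.SusceptibilityToPoincare`, FS ⇒ UP), lead c5 (cycle 4 of line
`rg-variance-cascade`).  The landed bottleneck lemma (`Negative/Bottleneck.lean`, `not_uniformHeatBathPoincare_of_bottleneck`)
refutes UP(r, β) from events `A S` of Wilson mass in a FIXED window `[δ, 1 − δ]` with heat-bath boundary flux `→ 0`.  The mass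
window is not needed: the Poincaré inequality with constant `C` gives `μ(A)(1 − μ(A)) ≤ C · ℰ_hb(1_A)` for every measurable
`A`, hence `1 − μ(A) ≤ C · ℰ_hb(1_A) / μ(A)` whenever `μ(A) > 0` — a METASTABLE family (conditional escape flux
`ℰ_hb(1_{A S}) / μ(A S) → 0`) of mass bounded away from `1` refutes UP even if `μ(A S) → 0`.

Consequence recorded for the disprover and the tenure planner (ASSESSMENT-c5.md of the crux): conjunct (ii) of the registered open
statement `Literature.MathematicalPhysics.QuantumFieldTheory.TwistSectorInputs` ("sector mass in `[δ, 1 − δ]`", 't Hooft's LIGHT magnetic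
flux) can be weakened to "minority-sector mass `≥ e^{−c′S}`" against a flux bound `e^{−cS}`, `c′ < c` — a LINEAR bound on the
magnetic-flux free energy, `F_m(S) ≤ c′S`, is all the twist-sector refutation of the typed crux needs.  Every compact `G`, every
lattice representation `r`, every real `β`; nothing here asserts a Theses statement.
-/

noncomputable section

namespace Summit.QuantumFields.YangMills.Theorems.SusceptibilityToPoincare.Negative

open MeasureTheory ProbabilityTheory Filter Topology
open Literature.MathematicalPhysics.QuantumFieldTheory

variable {G : Type} [Group G] [TopologicalSpace G] [IsTopologicalGroup G] [CompactSpace G]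
  [MeasurableSpace G] [BorelSpace G]

/-- **Conditional-escape form of the bottleneck lemma.** If the single-link heat-bath Poincaré inequality holds with
constant `C` on the torus of side `2S+1`, then every measurable event `A` of positive Wilson mass satisfies
`1 − μ(A) ≤ C · ℰ_hb(1_A) / μ(A)`: the complement mass is bounded by `C` times the CONDITIONAL boundary flux of `A`. [folklore] -/
theorem one_sub_measureReal_le_of_heatBathPoincare (r : LatticeRep G) (β C : ℝ) (S : ℕ)
    (hC : ∀ F : GaugeConfig 4 (2 * S + 1) G → ℝ, Measurable F → (∃ M : ℝ, ∀ U, |F U| ≤ M) →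
      variance F (wilsonMeasure (d := 4) (L := 2 * S + 1) r.ρ β) ≤
        C * ∑ ℓ : Edge 4 (2 * S + 1), ∫ U, ∫ g, (F U - F (Function.update U ℓ g)) ^ 2
          ∂((haarProbability G).tilted (fun g' => -β * wilsonAction r.ρ (Function.update U ℓ g')))
          ∂(wilsonMeasure (d := 4) (L := 2 * S + 1) r.ρ β))
    {A : Set (GaugeConfig 4 (2 * S + 1) G)} (hA : MeasurableSet A)
    (hpos : 0 < (wilsonMeasure (d := 4) (L := 2 * S + 1) r.ρ β).real A) :
    1 - (wilsonMeasure (d := 4) (L := 2 * S + 1) r.ρ β).real A ≤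
      C * (∑ ℓ : Edge 4 (2 * S + 1), ∫ U, ∫ g,
          (A.indicator (1 : GaugeConfig 4 (2 * S + 1) G → ℝ) U - A.indicator 1 (Function.update U ℓ g)) ^ 2
        ∂((haarProbability G).tilted (fun g' => -β * wilsonAction r.ρ (Function.update U ℓ g')))
        ∂(wilsonMeasure (d := 4) (L := 2 * S + 1) r.ρ β)) /
        (wilsonMeasure (d := 4) (L := 2 * S + 1) r.ρ β).real A := by
  have h := measureReal_mul_le_of_heatBathPoincare r β C S hC hA
  rw [le_div_iff₀ hpos]
  calc (1 - (wilsonMeasure (d := 4) (L := 2 * S + 1) r.ρ β).real A) *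
        (wilsonMeasure (d := 4) (L := 2 * S + 1) r.ρ β).real A
      = (wilsonMeasure (d := 4) (L := 2 * S + 1) r.ρ β).real A *
        (1 - (wilsonMeasure (d := 4) (L := 2 * S + 1) r.ρ β).real A) := by ring
    _ ≤ _ := h

/-- **No uniform heat-bath Poincaré inequality across a metastable family.** If along the tori of sides `2S+1` there are
measurable events `A S` of POSITIVE Wilson mass at most `1 − δ` (`δ > 0`; the mass may tend to `0`) whose CONDITIONAL
single-link heat-bath boundary flux `ℰ_hb(1_{A S}) / μ_{β,S}(A S)` tends to `0`, then UP(r, β) — verbatim the conclusion of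
`SusceptibilityToPoincare` at `(G, r, β)` — is false.  (The window form `not_uniformHeatBathPoincare_of_bottleneck` is the case
`δ ≤ μ(A S)`, where conditional and absolute flux are comparable.)  Registered rider of crux stmt-QuantumFields-9441 (∀-form). [folklore] -/
theorem not_uniformHeatBathPoincare_of_metastable :
    ∀ (G : Type) [Group G] [TopologicalSpace G] [IsTopologicalGroup G] [CompactSpace G] [MeasurableSpace G] [BorelSpace G]
      (r : LatticeRep G) (β δ : ℝ), 0 < δ → ∀ (A : ∀ S : ℕ, Set (GaugeConfig 4 (2 * S + 1) G)),
      (∀ S, MeasurableSet (A S)) →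
      (∀ S, 0 < (wilsonMeasure (d := 4) (L := 2 * S + 1) r.ρ β).real (A S) ∧
        (wilsonMeasure (d := 4) (L := 2 * S + 1) r.ρ β).real (A S) ≤ 1 - δ) →
      Tendsto (fun S : ℕ => (∑ ℓ : Edge 4 (2 * S + 1), ∫ U, ∫ g,
          ((A S).indicator (1 : GaugeConfig 4 (2 * S + 1) G → ℝ) U - (A S).indicator 1 (Function.update U ℓ g)) ^ 2
        ∂((haarProbability G).tilted (fun g' => -β * wilsonAction r.ρ (Function.update U ℓ g')))
        ∂(wilsonMeasure (d := 4) (L := 2 * S + 1) r.ρ β)) /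
          (wilsonMeasure (d := 4) (L := 2 * S + 1) r.ρ β).real (A S)) atTop (𝓝 0) →
      ¬ ∃ C : ℝ, ∀ S : ℕ, ∀ F : GaugeConfig 4 (2 * S + 1) G → ℝ, Measurable F → (∃ M : ℝ, ∀ U, |F U| ≤ M) →
        variance F (wilsonMeasure (d := 4) (L := 2 * S + 1) r.ρ β) ≤
          C * ∑ ℓ : Edge 4 (2 * S + 1), ∫ U, ∫ g, (F U - F (Function.update U ℓ g)) ^ 2
            ∂((haarProbability G).tilted (fun g' => -β * wilsonAction r.ρ (Function.update U ℓ g')))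
            ∂(wilsonMeasure (d := 4) (L := 2 * S + 1) r.ρ β) := by
  intro G _ _ _ _ _ _ r β δ hδ A hmeas hmass hflux
  rintro ⟨C, hC⟩
  have hle : ∀ S : ℕ, δ ≤ C * ((∑ ℓ : Edge 4 (2 * S + 1), ∫ U, ∫ g,
        ((A S).indicator (1 : GaugeConfig 4 (2 * S + 1) G → ℝ) U - (A S).indicator 1 (Function.update U ℓ g)) ^ 2
      ∂((haarProbability G).tilted (fun g' => -β * wilsonAction r.ρ (Function.update U ℓ g')))
      ∂(wilsonMeasure (d := 4) (L := 2 * S + 1) r.ρ β)) /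
        (wilsonMeasure (d := 4) (L := 2 * S + 1) r.ρ β).real (A S)) := fun S => by
    have h := one_sub_measureReal_le_of_heatBathPoincare r β C S (hC S) (hmeas S) (hmass S).1
    rw [mul_div_assoc] at h
    linarith [(hmass S).2]
  have hlim := hflux.const_mul C
  rw [mul_zero] at hlim
  have : δ ≤ 0 := ge_of_tendsto hlim (Eventually.of_forall hle)
  linarith

end Summit.QuantumFields.YangMills.Theorems.SusceptibilityToPoincare.Negative
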